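import Summits.CriticalPhenomena.PercolationContinuityZ3.Theses.PercNearOneGluing
import Literature.Probability.Percolation.PercolationEvents
import HarnessLib.Audit
import Literature.Probability.LatticeModels.ProdBernoulliIndependence
import Summits.CriticalPhenomena.PercolationContinuityZ3.Theorems.PercNearOneGluingAdditiveGluingOneBond
import Summits.CriticalPhenomena.PercolationContinuityZ3.Theorems.PercNearOneGluingNearOneGluingPivotalityDomination

/-! # The shortening step reduces to a set-relay exchange inequality in the uncontracted graph

Helper for `stub_shorteningStep` of line `kn_shortening_induction` (stmt-CriticalPhenomena-4574;
Kozma–Nitzan arXiv:2401.12397, Conjecture 6 p. 34).  Write `μ = prodBernoulli w`,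
`μ₁ = prodBernoulli (w[s(v,x) ↦ 1])`, `V = {v, x}`, `{V ↔ z} = {v ↔ z} ∪ {x ↔ z}` and, for a relay set
`A` and a designated relay `a₀`,
`Q = {V ↔ A} ∩ {V ↮ a₀}` (some relay is joined to the pair, `a₀` is not).
We prove, for EVERY finite relay set `A` and with no induction hypothesis, that the glued
inequality (40) of Kozma–Nitzan,
`μ₁(v ↔ A) · μ₁(a₀ ↔ b) ≤ μ₁(v ↔ b)`,
follows from the single exchange inequality
`μ({a₀ ↔ b} ∩ Q) ≤ μ({V ↔ b} ∩ Q)`                                         (SRX)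
in the UNCONTRACTED measure `μ`.  For `A ⊆ {a₀, a₁}` (SRX) is Kozma–Nitzan's Lemma 3 for the
mixed-monotone observer event `{V ↔ a₁} ∩ {V ↮ a₀}` under the minimiser hypothesis
`μ(a₀ ↔ b) ≤ μ(a₁ ↔ b)` (`knLemma3Mixed_setObserver_star`), which is how the `|A| ≤ 2` case
(`stub_shorteningStep_var2415`) was closed; for a one-point source `V = {o}` and `a₀` the minimiser
of `μ(· ↔ b)` on `A`, (SRX) is exactly Kozma–Nitzan's Question 7 (p. 36, inequality (41):
`P(o ↔ b, o ↔ A) ≥ P(o ↔ A, a₀ ↔ b)`, add `μ(o ↔ a₀ ↔ b)` to both sides).  So Conjecture 6 — for all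
`|A|`, unconditionally — is implied by Question 7 asked at the glued pair against the pre-gluing
minimiser; this file records the implication, the open kernel being (SRX).

Proof (the `|A| ≤ 2` template made uniform in `A`): transport the three glued probabilities to `μ`
along `ω ↦ insert s(v,x) ω` (`goodStepEI_prodBernoulli_map_insert`, `pivDom_reachable_insert`):
`μ₁(v ↔ A) ≤ μ(E)`, `E = ⋃_{a ∈ A} {V ↔ a}`; `μ₁(a₀ ↔ b) ≤ μ(K)`,
`K = {a₀ ↔ b} ∪ ({a₀ ↔ v} ∩ {x ↔ b}) ∪ ({a₀ ↔ x} ∩ {v ↔ b})`; `μ(V ↔ b) ≤ μ₁(v ↔ b)`.  Harris gives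
`μ(E) μ(K) ≤ μ(E ∩ K)`, and pointwise `E ∩ K ⊆ ({V ↔ b} ∩ {a₀ ↔ V}) ∪ ({a₀ ↔ b} ∩ Q)`,
`{V ↔ b} ∩ Q ⊆ {V ↔ b} ∖ {a₀ ↔ V}`; (SRX) closes the chain. -/

namespace Summit.CriticalPhenomena.PercolationContinuityZ3.Theorems

open MeasureTheory Set Literature.Probability.LatticeModels Literature.Probability.Percolation
open scoped Classical BigOperators

/-- **Shortening step from the set-relay exchange inequality.**  For any weights `w`, relay set
`A`, vertices `b, v ≠ x, a₀`: if in `μ = prodBernoulli w` the exchange inequality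
`μ({a₀ ↔ b} ∩ Q) ≤ μ({V ↔ b} ∩ Q)` holds for `V = {v, x}` and
`Q = {∃ a ∈ A, V ↔ a} ∩ {V ↮ a₀}`, then in the glued measure `μ₁ = prodBernoulli (w[s(v,x) ↦ 1])`
Kozma–Nitzan's inequality (40) holds against `a₀`:
`μ₁(v ↔ A) · μ₁(a₀ ↔ b) ≤ μ₁(v ↔ b)` (arXiv:2401.12397, Conjecture 6; no minimality, no
induction hypothesis and no bound on `|A|` are needed for this implication). -/
theorem shorteningStep_of_setRelayExchange : ∀ (n : ℕ) (w : Sym2 (Fin n) → unitInterval) (A : Finset (Fin n)) (b v x a₀ : Fin n), v ≠ x → (Literature.Probability.LatticeModels.prodBernoulli w).real (Literature.Probability.Percolation.openConn a₀ b ∩ {ω : Literature.Probability.Percolation.BondConfig (Fin n) | (∃ a ∈ A, ∃ y ∈ ({v, x} : Finset (Fin n)), (Literature.Probability.Percolation.openGraph ω).Reachable a y) ∧ ∀ y ∈ ({v, x} : Finset (Fin n)), ¬ (Literature.Probability.Percolation.openGraph ω).Reachable a₀ y}) ≤ (Literature.Probability.LatticeModels.prodBernoulli w).real ({ω : Literature.Probability.Percolation.BondConfig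 (Fin n) | ∃ y ∈ ({v, x} : Finset (Fin n)), (Literature.Probability.Percolation.openGraph ω).Reachable y b} ∩ {ω : Literature.Probability.Percolation.BondConfig (Fin n) | (∃ a ∈ A, ∃ y ∈ ({v, x} : Finset (Fin n)), (Literature.Probability.Percolation.openGraph ω).Reachable a y) ∧ ∀ y ∈ ({v, x} : Finset (Fin n)), ¬ (Literature.Probability.Percolation.openGraph ω).Reachable a₀ y}) → (Literature.Probability.LatticeModels.prodBernoulli (Function.update w s(v, x) 1)).real (⋃ a ∈ A, Literature.Probability.Percolation.openConn v a) * (Literature.Probability.LatticeModels.prodBernoulli (Function.update w s(v, x) 1)).real (Literature.Probability.Percolation.openConn a₀ b) ≤ (Literature.Probability.LatticeModels.prodBernoulli (Function.update w s(v, x) 1)).real (Literature.Probability.Percolation.openConn v b) := by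
  intro n w A b v x a₀ hvx hSRX
  -- every event is measurable on the finite configuration space
  have hmeas : ∀ S : Set (BondConfig (Fin n)), MeasurableSet S := fun S =>
    MeasurableSet.of_discrete
  -- transport along `ω ↦ insert s(v,x) ω`, whose image measure is the glued measure
  have hmi : Measurable fun ω : BondConfig (Fin n) => insert s(v, x) ω := by
    refine measurable_set_iff.2 fun i => ?_
    simp only [Set.mem_insert_iff]
    exact measurable_const.or (measurable_set_mem i)
  have htrans : ∀ F : Set (BondConfig (Fin n)),
      (prodBernoulli (Function.update w s(v, x) 1)).real F =
        (prodBernoulli w).real ((fun ω : BondConfig (Fin n) => insert s(v, x) ω) ⁻¹' F) := by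
    intro F
    rw [← goodStepEI_prodBernoulli_map_insert w s(v, x), map_measureReal_apply hmi (hmeas F)]
  -- the events of the uncontracted graph (`V = {v, x}`)
  set Fb : Set (BondConfig (Fin n)) := openConn v b ∪ openConn x b with hFb
  set E : Set (BondConfig (Fin n)) := ⋃ a ∈ A, (openConn v a ∪ openConn x a) with hE
  set K : Set (BondConfig (Fin n)) :=
    openConn a₀ b ∪ ((openConn a₀ v ∩ openConn x b) ∪ (openConn a₀ x ∩ openConn v b)) with hK
  set T : Set (BondConfig (Fin n)) := openConn a₀ v ∪ openConn a₀ x with hT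
  set Q : Set (BondConfig (Fin n)) :=
    {ω : BondConfig (Fin n) |
      (∃ a ∈ A, ∃ y ∈ ({v, x} : Finset (Fin n)), (openGraph ω).Reachable a y) ∧
        ∀ y ∈ ({v, x} : Finset (Fin n)), ¬ (openGraph ω).Reachable a₀ y} with hQ
  set Sb : Set (BondConfig (Fin n)) :=
    {ω : BondConfig (Fin n) | ∃ y ∈ ({v, x} : Finset (Fin n)), (openGraph ω).Reachable y b} with hSb
  -- (1) the three transports
  have hX : (prodBernoulli w).real Fb ≤
      (prodBernoulli (Function.update w s(v, x) 1)).real (openConn v b) := by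
    rw [htrans]
    refine measureReal_mono (fun ω hω => ?_)
    rcases hω with h | h
    · exact (h : (openGraph ω).Reachable v b).mono (openGraph_mono (Set.subset_insert _ _))
    · exact pivDom_reachable_insert_of ω hvx h
  have hY : (prodBernoulli (Function.update w s(v, x) 1)).real (⋃ a ∈ A, openConn v a) ≤
      (prodBernoulli w).real E := by
    rw [htrans]
    refine measureReal_mono (fun ω hω => ?_) (measure_ne_top _ _)
    simp only [Set.mem_preimage, Set.mem_iUnion, exists_prop] at hω
    obtain ⟨a, ha, h⟩ := hω
    have h' : (openGraph ω).Reachable v a ∨ (openGraph ω).Reachable x a := by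
      rcases pivDom_reachable_insert ω v x v a h with h1 | ⟨-, h1⟩ | ⟨-, h1⟩
      exacts [Or.inl h1, Or.inr h1, Or.inl h1]
    exact Set.mem_iUnion₂.2 ⟨a, ha, h'⟩
  have hZ : (prodBernoulli (Function.update w s(v, x) 1)).real (openConn a₀ b) ≤
      (prodBernoulli w).real K := by
    rw [htrans]
    refine measureReal_mono (fun ω hω => ?_)
    rcases pivDom_reachable_insert ω v x a₀ b hω with h1 | ⟨h1, h2⟩ | ⟨h1, h2⟩
    exacts [Or.inl h1, Or.inr (Or.inl ⟨h1, h2⟩), Or.inr (Or.inr ⟨h1, h2⟩)]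
  -- (2) Harris for the increasing events `E`, `K`
  have hEup : IsUpperSet E :=
    isUpperSet_iUnion₂ fun a _ => (isUpperSet_openConn v a).union (isUpperSet_openConn x a)
  have hKup : IsUpperSet K :=
    (isUpperSet_openConn a₀ b).union
      (((isUpperSet_openConn a₀ v).inter (isUpperSet_openConn x b)).union
        ((isUpperSet_openConn a₀ x).inter (isUpperSet_openConn v b)))
  have hHarris : (prodBernoulli w).real E * (prodBernoulli w).real K ≤
      (prodBernoulli w).real (E ∩ K) :=
    prodBernoulli_harris w hEup hKup (hmeas _) (hmeas _)
  -- (3) event algebra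
  have hsplit : E ∩ K ⊆ (Fb ∩ T) ∪ (openConn a₀ b ∩ Q) := by
    rintro ω ⟨hωE, hωK⟩
    by_cases hT' : ω ∈ T
    · left
      refine ⟨?_, hT'⟩
      rcases hωK with hab | ⟨_, hxb⟩ | ⟨_, hvb⟩
      · rcases hT' with hav | hax
        · exact Or.inl ((SimpleGraph.Reachable.symm hav).trans hab)
        · exact Or.inr ((SimpleGraph.Reachable.symm hax).trans hab)
      · exact Or.inr hxb
      · exact Or.inl hvb
    · right
      have hav : ¬ (openGraph ω).Reachable a₀ v := fun h => hT' (Or.inl h)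
      have hax : ¬ (openGraph ω).Reachable a₀ x := fun h => hT' (Or.inr h)
      refine ⟨?_, ?_, ?_⟩
      · rcases hωK with hab | ⟨h, _⟩ | ⟨h, _⟩
        exacts [hab, absurd h hav, absurd h hax]
      · obtain ⟨a, ha, h⟩ := Set.mem_iUnion₂.1 hωE
        rcases h with h | h
        · exact ⟨a, ha, v, by simp, SimpleGraph.Reachable.symm h⟩
        · exact ⟨a, ha, x, by simp, SimpleGraph.Reachable.symm h⟩
      · intro y hy
        simp only [Finset.mem_insert, Finset.mem_singleton] at hy
        rcases hy with hy | hy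
        · rw [hy]; exact hav
        · rw [hy]; exact hax
  have hSbQ : Sb ∩ Q ⊆ Fb \ T := by
    rintro ω ⟨⟨y, hy, hyb⟩, -, hno⟩
    refine ⟨?_, ?_⟩
    · simp only [Finset.mem_insert, Finset.mem_singleton] at hy
      rcases hy with hy | hy
      · rw [hy] at hyb; exact Or.inl hyb
      · rw [hy] at hyb; exact Or.inr hyb
    · rintro (h | h)
      · exact hno v (by simp) h
      · exact hno x (by simp) h
  -- (4) assemble with the exchange hypothesis `hSRX : μ({a₀ ↔ b} ∩ Q) ≤ μ(Sb ∩ Q)`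
  have hFsum : (prodBernoulli w).real (Fb ∩ T) + (prodBernoulli w).real (Fb \ T) =
      (prodBernoulli w).real Fb :=
    measureReal_inter_add_sdiff (hmeas T)
  have h1 : (prodBernoulli w).real (E ∩ K) ≤
      (prodBernoulli w).real (Fb ∩ T) + (prodBernoulli w).real (openConn a₀ b ∩ Q) :=
    (measureReal_mono hsplit).trans (measureReal_union_le _ _)
  have h2 : (prodBernoulli w).real (Sb ∩ Q) ≤ (prodBernoulli w).real (Fb \ T) :=
    measureReal_mono hSbQ
  calc (prodBernoulli (Function.update w s(v, x) 1)).real (⋃ a ∈ A, openConn v a) *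
        (prodBernoulli (Function.update w s(v, x) 1)).real (openConn a₀ b)
      ≤ (prodBernoulli w).real E * (prodBernoulli w).real K :=
        mul_le_mul hY hZ measureReal_nonneg measureReal_nonneg
    _ ≤ (prodBernoulli w).real (E ∩ K) := hHarris
    _ ≤ (prodBernoulli w).real Fb := by linarith
    _ ≤ (prodBernoulli (Function.update w s(v, x) 1)).real (openConn v b) := hX

end Summit.CriticalPhenomena.PercolationContinuityZ3.Theorems
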